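/-
# fwd-rung G1 on seed g1-QuantumFields-16262 — is there a rung above the germ lemma?  (planner-fwd-rung-QuantumFields-04, 2026-08-17)

FLOOR = `stub_anomalyGermVanishes : AnomalyGermVanishes` (Euclidean Coleman–Grossman germ lemma; item
stmt-QuantumFields-16262 of route-QuantumFields-AnomalyRigidity, PROVED p126118).

This file types the graded family `Rung M` indexed by the MASS-INDEX POLICY `M : ℝ → Set ℝ` (which masses
carry the five germ hypotheses, given the scale `m₁`):
* FLOOR = `Rung (fun m₁ => Set.Ioc 0 m₁)` — theorems `rung_floor`, `floor_iff_rung_Ioc` (F3 half 1);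
* NEXT RUNG (one move: the index set `(0,m₁]` ↦ ANY positive set accumulating at `0⁺`, e.g. one sequence
  `m_n → 0⁺`) = `RungAccum`;
* FLATNESS CERTIFICATE `rungAccum_of_floor : AnomalyGermVanishes → RungAccum` (F3 half 2 FAILS: the floor
  already implies the rung, by mass reparametrisation) — hence `rungAccum`, `rung_of_accumulating` are
  THEOREMS (sorry-free corollaries of the floor), not cruxes, and no rung is filed from this seed;
* also banked: `RungQ` (quantitative single-mass form `‖c‖ ≤ κ·K·m` = the floor's internal lemma `key`).

CONSUMER NOTE (why the corollary is still worth having in the tree): every consumer of the germ lemma —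
`closes` of AnomalyRigidity via `AnomalousWardTriple` (b), and line `anomaly_corner` on
stmt-QuantumFields-16902 via `stub_cornerWardData` — currently asks for continuum Ward data at EVERY
`m ∈ (0,1]`, which needs one diagonal subsequence serving uncountably many masses (mass-equicontinuity /
Feynman–Hellmann equi-Lipschitz input).  `rung_of_accumulating` shows Ward data along ONE sequence
`m_n → 0⁺` suffices: countably many extractions, plain diagonal argument, no equicontinuity in `m`.
-/
import Summits.QuantumFields.QCD.Theorems.HeatSlicedQuarksRobustYangMillsHandoverStubAnomalyGermVanishes

namespace Summit.QuantumFields.QCD.Cruxes.AnomalousWardTriple.FwdRung04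

open Summit.QuantumFields.QCD.Theses.AnomalyRigidity

/-- The germ hypotheses of `AnomalyGermVanishes` at ONE mass `m` (text verbatim from the route file):
H1 B₄ pseudo-covariance · H2 bi-transversality `o(‖k‖²)` · H3 differentiability at `0` ·
H4 subtracted Ward germ · H5 mixed germ `B` of `Γ^P_m` with `‖B‖ ≤ K`. -/
def Clauses (Γ : ℝ → (Fin 4 → ℝ) → (Fin 4 → ℝ) → Fin 4 → Fin 4 → Fin 4 → ℂ)
    (ΓP : ℝ → (Fin 4 → ℝ) → (Fin 4 → ℝ) → Fin 4 → Fin 4 → ℂ) (c : ℂ) (κ K m : ℝ) : Prop :=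
  let V8 := (Fin 4 → ℝ) × (Fin 4 → ℝ); let q2 := fun k : V8 => ‖k‖ ^ 2;
  (∀ R : Matrix (Fin 4) (Fin 4) ℝ, (∀ i j, R i j = 0 ∨ R i j = 1 ∨ R i j = -1) → R * R.transpose = 1 → ∀ (p q : (Fin 4 → ℝ)) μ ν la, Γ m (R.mulVec p) (R.mulVec q) μ ν la = ((R.det : ℝ) : ℂ) * ∑ μ', ∑ ν', ∑ la', ((R μ μ' * R ν ν' * R la la' : ℝ) : ℂ) * Γ m p q μ' ν' la') ∧ (∀ ν la, (fun k : V8 => ∑ μ : Fin 4, ((k.1 μ : ℝ) : ℂ) * Γ m k.1 k.2 μ ν la) =o[nhds 0] q2) ∧ (∀ μ la, (fun k : V8 => ∑ ν : Fin 4, ((k.2 ν : ℝ) : ℂ) * Γ m k.1 k.2 μ ν la) =o[nhds 0] q2) ∧ (∀ μ ν la, DifferentiableAt ℝ (fun k : V8 => Γ m k.1 k.2 μ ν la) 0) ∧ (∀ μ ν, (fun k : V8 => (∑ la : Fin 4, ((k.1 la + k.2 la : ℝ) : ℂ) * Γ m k.1 k.2 μ ν la) - ((κ * m : ℝ) : ℂ)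 * ΓP m k.1 k.2 μ ν - c * ((Matrix.det (Matrix.of ![Pi.single μ 1, Pi.single ν 1, k.1, k.2]) : ℝ) : ℂ)) =o[nhds 0] q2) ∧ (∀ μ ν, ∃ B : Fin 4 → Fin 4 → ℂ, (∀ al be, ‖B al be‖ ≤ K) ∧ (fun k : V8 => ΓP m k.1 k.2 μ ν - ΓP m k.1 0 μ ν - ΓP m 0 k.2 μ ν + ΓP m 0 0 μ ν - ∑ al : Fin 4, ∑ be : Fin 4, B al be * ((k.1 al : ℝ) : ℂ) * ((k.2 be : ℝ) : ℂ)) =o[nhds 0] q2)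

/-- GRADED FAMILY.  `Rung M`: the germ lemma when the hypotheses are available exactly at the masses
`m ∈ M m₁` (`m₁ > 0` the scale).  Monotone: smaller index sets make a stronger statement. -/
def Rung (M : ℝ → Set ℝ) : Prop :=
  ∀ (Γ : ℝ → (Fin 4 → ℝ) → (Fin 4 → ℝ) → Fin 4 → Fin 4 → Fin 4 → ℂ)
    (ΓP : ℝ → (Fin 4 → ℝ) → (Fin 4 → ℝ) → Fin 4 → Fin 4 → ℂ) (c : ℂ) (κ K m₁ : ℝ),
    0 < m₁ → 0 ≤ κ → (∀ m ∈ M m₁, Clauses Γ ΓP c κ K m) → c = 0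

/-- A set of reals accumulates at `0⁺` from inside: below every `δ > 0` it has an element. -/
def AccumulatesAtZero (S : Set ℝ) : Prop := ∀ δ : ℝ, 0 < δ → ∃ m ∈ S, m < δ

/-- NEXT RUNG (candidate R1, the `rung_decl`): the germ lemma for ANY policy of positive mass sets
accumulating at `0⁺` — e.g. a single sequence `m_n → 0⁺` — instead of the full interval `(0, m₁]`.
Consumer value: Ward data (`AnomalousWardTriple` (b) / `stub_cornerWardData`) would be needed at
countably many masses only (no mass-equicontinuity).  VERDICT: floor-equivalent (`rungAccum_of_floor`). -/
def RungAccum : Prop :=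
  ∀ M : ℝ → Set ℝ, (∀ m₁ : ℝ, 0 < m₁ → M m₁ ⊆ Set.Ioi 0 ∧ AccumulatesAtZero (M m₁)) → Rung M

/-- Candidate RQ (quantitative single-mass form): the germ clauses at ONE mass bound the anomaly
coefficient, `‖c‖ ≤ κ·K·m`.  Strictly stronger than the floor as a statement, but it is literally the
floor's internal lemma `key` (sub-proof; no new idea, no located failure point) — banked, not filed. -/
def RungQ : Prop :=
  ∀ (Γ : ℝ → (Fin 4 → ℝ) → (Fin 4 → ℝ) → Fin 4 → Fin 4 → Fin 4 → ℂ)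
    (ΓP : ℝ → (Fin 4 → ℝ) → (Fin 4 → ℝ) → Fin 4 → Fin 4 → ℂ) (c : ℂ) (κ K m : ℝ),
    0 < m → 0 ≤ κ → Clauses Γ ΓP c κ K m → ‖c‖ ≤ κ * K * m

/-- `RungQ` gives the floor back in three lines (so RQ ≥ floor); shown for calibration. -/
theorem rung_floor_of_rungQ (hQ : RungQ) : Rung (fun m₁ => Set.Ioc 0 m₁) := by
  intro Γ ΓP c κ K m₁ hm₁ hκ h
  have key : ∀ m : ℝ, 0 < m → m ≤ m₁ → ‖c‖ ≤ κ * K * m := fun m hm hm1 =>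
    hQ Γ ΓP c κ K m hm hκ (h m ⟨hm, hm1⟩)
  by_contra hc
  have hcpos : 0 < ‖c‖ := norm_pos_iff.mpr hc
  rcases le_or_gt (κ * K) 0 with hA | hA
  · have h1 := key m₁ hm₁ le_rfl
    nlinarith
  · have hmpos : 0 < min m₁ (‖c‖ / (2 * (κ * K))) := lt_min hm₁ (by positivity)
    have h1 := key _ hmpos (min_le_left _ _)
    have h2 : κ * K * min m₁ (‖c‖ / (2 * (κ * K))) ≤ κ * K * (‖c‖ / (2 * (κ * K))) :=
      mul_le_mul_of_nonneg_left (min_le_right _ _) hA.le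
    have hA0 : κ * K ≠ 0 := hA.ne'
    have h3 : κ * K * (‖c‖ / (2 * (κ * K))) = ‖c‖ / 2 := by
      rw [mul_comm, div_mul_eq_mul_div, mul_div_mul_right _ _ hA0]
    linarith


/-! ## F3 same-rung separation, half 1: the FLOOR is literally the family at the interval policy -/

open Summit.QuantumFields.QCD.Cruxes.RobustYangMillsHandover.LeeYangMassHandover in
/-- witness: `Rung (fun m₁ => Set.Ioc 0 m₁)` IS `AnomalyGermVanishes` (the seed theorem
`stub_anomalyGermVanishes`), up to `m ∈ Set.Ioc 0 m₁ ↔ 0 < m ∧ m ≤ m₁`. -/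
theorem rung_floor : Rung (fun m₁ => Set.Ioc 0 m₁) := by
  intro Γ ΓP c κ K m₁ hm₁ hκ h
  exact stub_anomalyGermVanishes Γ ΓP c κ K m₁ hm₁ hκ (fun m hm hm1 => h m ⟨hm, hm1⟩)

/-- … and conversely: the floor statement is exactly the interval rung (definitional repackaging). -/
theorem floor_iff_rung_Ioc : AnomalyGermVanishes ↔ Rung (fun m₁ => Set.Ioc 0 m₁) := by
  constructor
  · intro hf Γ ΓP c κ K m₁ hm₁ hκ h
    exact hf Γ ΓP c κ K m₁ hm₁ hκ (fun m hm hm1 => h m ⟨hm, hm1⟩)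
  · intro hr Γ ΓP c κ K m₁
    dsimp only
    intro hm₁ hκ h
    exact hr Γ ΓP c κ K m₁ hm₁ hκ (fun m hm => h m hm.1 hm.2)

/-! ## F3 same-rung separation, half 2: `floor → RungAccum` MUST NOT close cheaply — but it DOES.
The next rung is floor-EQUIVALENT by mass reparametrisation (`σ m ∈ M m₁ ∩ (0, m]`,
`Γ' m := Γ (σ m)`, `Γ^P' m := (σ m / m) • Γ^P (σ m)`; the Ward coefficient `κ·m·(σ m/m) = κ·σ m` and the
germ bound `(σ m/m)·K ≤ K` are preserved).  Kernel certificate of FLATNESS: -/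

/-- pulling a scalar out of the bilinear germ. -/
private theorem sum_scale (C : ℂ) (B : Fin 4 → Fin 4 → ℂ) (p q : Fin 4 → ℝ) :
    ∑ al : Fin 4, ∑ be : Fin 4, C * B al be * ((p al : ℝ) : ℂ) * ((q be : ℝ) : ℂ) =
      C * ∑ al : Fin 4, ∑ be : Fin 4, B al be * ((p al : ℝ) : ℂ) * ((q be : ℝ) : ℂ) := by
  simp only [Finset.mul_sum]
  exact Finset.sum_congr rfl (fun _ _ => Finset.sum_congr rfl (fun _ _ => by ring))

/-- FLATNESS: the floor already implies the next rung (so R1 is not filed). -/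
theorem rungAccum_of_floor (hfloor : AnomalyGermVanishes) : RungAccum := by
  intro M hM Γ ΓP c κ K m₁ hm₁ hκ h
  obtain ⟨hMpos, hMacc⟩ := hM m₁ hm₁
  have hsel : ∀ m : ℝ, 0 < m → ∃ s : ℝ, s ∈ M m₁ ∧ 0 < s ∧ s ≤ m := fun m hm => by
    obtain ⟨s, hs, hsm⟩ := hMacc m hm
    exact ⟨s, hs, hMpos hs, hsm.le⟩
  choose! σ hσM hσpos hσle using hsel
  -- the reparametrised family `Γ' m := Γ (σ m)`, `Γ^P' m := (σ m / m) • Γ^P (σ m)`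
  refine hfloor (fun m => Γ (σ m)) (fun m p q μ ν => ((σ m / m : ℝ) : ℂ) * ΓP (σ m) p q μ ν)
    c κ K m₁ hm₁ hκ ?_
  intro m hm hm1
  obtain ⟨h1, h2, h3, h4, h5, h6⟩ := h (σ m) (hσM m hm)
  refine ⟨h1, h2, h3, h4, fun μ ν => ?_, fun μ ν => ?_⟩
  · -- Ward germ: `κ·m·(σ m/m) = κ·σ m`
    have e : ((κ * m : ℝ) : ℂ) * ((σ m / m : ℝ) : ℂ) = ((κ * σ m : ℝ) : ℂ) := by
      rw [← Complex.ofReal_mul]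
      congr 1
      rw [mul_assoc, mul_div_cancel₀ _ hm.ne']
    refine (h5 μ ν).congr' (Filter.Eventually.of_forall fun k => ?_) Filter.EventuallyEq.rfl
    dsimp only
    linear_combination (ΓP (σ m) k.1 k.2 μ ν) * e
  · -- mixed germ: `B' := (σ m/m) • B`, `‖B'‖ ≤ (σ m/m)·K ≤ K`
    obtain ⟨B, hBK, hB⟩ := h6 μ ν
    have hr0 : 0 ≤ σ m / m := div_nonneg (hσpos m hm).le hm.le
    have hr1 : σ m / m ≤ 1 := (div_le_one hm).mpr (hσle m hm)
    refine ⟨fun al be => ((σ m / m : ℝ) : ℂ) * B al be, fun al be => ?_, ?_⟩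
    · rw [norm_mul, Complex.norm_real, Real.norm_of_nonneg hr0]
      calc σ m / m * ‖B al be‖ ≤ 1 * ‖B al be‖ :=
            mul_le_mul_of_nonneg_right hr1 (norm_nonneg _)
        _ = ‖B al be‖ := one_mul _
        _ ≤ K := hBK al be
    · refine (hB.const_mul_left ((σ m / m : ℝ) : ℂ)).congr'
        (Filter.Eventually.of_forall fun k => ?_) Filter.EventuallyEq.rfl
      dsimp only
      rw [sum_scale]
      ring

/-- Hence the next rung is a THEOREM already (floor proved ⇒ rung proved): bankable corollary,
e.g. Ward data along one sequence `m_n → 0⁺` suffices for the germ lemma. -/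
theorem rungAccum : RungAccum :=
  rungAccum_of_floor (floor_iff_rung_Ioc.mpr rung_floor)

/-- the sequence instance most consumers want: hypotheses along `m_n = (n+2)⁻¹·m₁`-type sets, here any
`S ⊆ (0,∞)` accumulating at `0⁺`, independent of the scale `m₁`. -/
theorem rung_of_accumulating (S : Set ℝ) (hS : S ⊆ Set.Ioi 0) (hacc : AccumulatesAtZero S) :
    Rung (fun _ => S) :=
  rungAccum (fun _ => S) (fun _ _ => ⟨hS, hacc⟩)

end Summit.QuantumFields.QCD.Cruxes.AnomalousWardTriple.FwdRung04
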